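import Mathlib.Analysis.Calculus.BumpFunction.Convolution
import Mathlib.Analysis.Calculus.BumpFunction.FiniteDimension
import Mathlib.Analysis.Calculus.ContDiff.Convolution
import Mathlib.Topology.UniformSpace.HeineCantor
import Mathlib.Topology.UrysohnsLemma
import Mathlib.MeasureTheory.Function.AEEqOfIntegral
import Literature.Analysis.FunctionSpaces.TorusMollifier
import Literature.Analysis.FunctionSpaces.TorusTestFunction
import HarnessLib

/-!
# Smooth approximation on space–time `ℝ × T^d` and a du Bois-Reymond lemma

Support file for the discharge of the named fact
`Literature.Barriers.AnomalousDissipation.DeRosaInversi2024_thm12` (`CodimensionOneRigidity.lean`).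
Two density statements on `X = ℝ × T^d`, phrased in the tree's space–time vocabulary
(`Torus.stLift`, smoothness of `χ : ℝ → T^d → ℝ` meaning `ContDiff ℝ ∞ (Torus.stLift χ)`):

* `exists_smooth_near`: every continuous compactly supported `g : ℝ × T^d → ℝ` is uniformly
  `δ`-close to a smooth space–time function `χ` vanishing outside a compact time interval
  (mollify the periodic lift `g ∘ (id × proj)` on `ℝ × ℝ^d` by a normed bump function; the
  mollification stays lattice periodic and descends; Evans, *PDE*, App. C.4, Thm. 7).
* `ae_eq_zero_of_forall_smooth_integral_eq_zero`: if `m ∈ L¹(μ)` for a finite Borel measure `μ`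
  on `ℝ × T^d` and `∫ χ m dμ = 0` for all such smooth `χ`, then `m = 0` `μ`-a.e. (the previous
  item, then continuous Urysohn functions of compact sets and dominated convergence, as in
  Mathlib's `ae_eq_zero_of_integral_contMDiff_smul_eq_zero`; Evans, §5.2.1, uniqueness of weak
  derivatives). This is how `div u = 0` is converted into `tr M = 0` `|∇u|`-a.e. in
  De Rosa–Inversi 2024, §4, display (4.1).

Everything is proved; theorems only.

## References

* L. C. Evans, *Partial Differential Equations*, 2nd ed. (2010), App. C.4 Thm. 7, §5.2.1.
* L. De Rosa, M. Inversi, Comm. Math. Phys. 405 (2024), §4 (arXiv:2307.09189).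
-/

noncomputable section

open MeasureTheory TopologicalSpace Set Function Filter Topology Metric ContinuousLinearMap
open scoped ENNReal NNReal Convolution ContDiff

namespace Literature.Barriers.AnomalousDissipation

namespace CodimensionOneRigidity

open Literature.Analysis Literature.Analysis.FunctionSpaces

variable {d : Type*} [Fintype d]

/-! ### Smooth uniform approximation of `C_c(ℝ × T^d)` -/

/-- The covering map `id × proj : ℝ × ℝ^d → ℝ × T^d` does not increase distances. [folklore] -/
theorem dist_prodMap_proj_le (p q : ℝ × EuclideanSpace ℝ d) :
    dist ((p.1, Torus.proj p.2) : ℝ × UnitAddTorus d) (q.1, Torus.proj q.2) ≤ dist p q := by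
  rw [Prod.dist_eq, Prod.dist_eq]
  refine max_le_max le_rfl ?_
  rw [dist_eq_norm, dist_eq_norm, show Torus.proj p.2 - Torus.proj q.2 = Torus.proj (p.2 - q.2)
    from rfl]
  exact Torus.norm_proj_le _

/-- A smooth space–time function vanishing outside a compact time interval is bounded and its
uncurried version is continuous. [folklore] -/
theorem continuous_uncurry_and_bounded {χ : ℝ → UnitAddTorus d → ℝ}
    (hχ : ContDiff ℝ ∞ (Torus.stLift χ)) {a b : ℝ} (hab : ∀ t ∉ Icc a b, χ t = 0) :
    Continuous (uncurry χ) ∧ ∃ C, ∀ q, ‖uncurry χ q‖ ≤ C := by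
  have hc : Continuous (uncurry χ) := Torus.continuous_uncurry_of_continuous_stLift hχ.continuous
  refine ⟨hc, hc.bounded_above_of_compact_support ?_⟩
  refine HasCompactSupport.intro' (K := Icc a b ×ˢ (univ : Set (UnitAddTorus d)))
    (isCompact_Icc.prod isCompact_univ) (isClosed_Icc.prod isClosed_univ) fun q hq => ?_
  have ht : q.1 ∉ Icc a b := fun h => hq ⟨h, mem_univ _⟩
  simp [uncurry, hab q.1 ht]

/-- **Smooth functions are uniformly dense in `C_c(ℝ × T^d)`**, within the class of smooth
space–time functions vanishing outside a compact time interval (mollification of the periodic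
lift; Evans, App. C.4, Thm. 7 (ii)). [folklore] -/
theorem exists_smooth_near {g : ℝ × UnitAddTorus d → ℝ} (hg : Continuous g)
    (hgc : HasCompactSupport g) {δ : ℝ} (hδ : 0 < δ) :
    ∃ χ : ℝ → UnitAddTorus d → ℝ, ContDiff ℝ ∞ (Torus.stLift χ) ∧
      (∃ a b : ℝ, ∀ t ∉ Icc a b, χ t = 0) ∧ ∀ t x, |χ t x - g (t, x)| ≤ δ := by
  classical
  -- uniform continuity of `g`
  obtain ⟨r, hr, hru⟩ := Metric.uniformContinuous_iff.1 (hgc.uniformContinuous_of_continuous hg)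
    δ hδ
  -- the periodic lift `G` of `g`
  set G : ℝ × EuclideanSpace ℝ d → ℝ := fun p => g (p.1, Torus.proj p.2) with hGdef
  have hGc : Continuous G :=
    hg.comp (continuous_fst.prodMk (Torus.continuous_proj.comp continuous_snd))
  -- mollify on `ℝ × ℝ^d` (product Lebesgue measure, an additive Haar measure)
  haveI : (volume : Measure (ℝ × EuclideanSpace ℝ d)).IsAddHaarMeasure :=
    Measure.prod.instIsAddHaarMeasure _ _
  set β : ContDiffBump (0 : ℝ × EuclideanSpace ℝ d) := ⟨r / 2, r, half_pos hr, half_lt_self hr⟩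
    with hβ
  set H : ℝ × EuclideanSpace ℝ d → ℝ := β.normed volume ⋆[lsmul ℝ ℝ, volume] G with hHdef
  have hHs : ContDiff ℝ ∞ H :=
    β.hasCompactSupport_normed.contDiff_convolution_left _ β.contDiff_normed
      (hGc.locallyIntegrable (μ := volume))
  have hHclose : ∀ p, dist (H p) (G p) ≤ δ := fun p =>
    β.dist_normed_convolution_le hGc.aestronglyMeasurable fun x hx =>
      (hru ((dist_prodMap_proj_le x p).trans_lt (mem_ball.1 hx))).le
  have hHapply : ∀ p, H p = ∫ s, β.normed volume s * G (p - s) := fun p => by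
    rw [hHdef, convolution_lsmul]; rfl
  -- lattice periodicity of the mollification
  have hper : ∀ (t : ℝ) (y : EuclideanSpace ℝ d) (k : d → ℤ),
      H (t, y + Torus.latticeVec k) = H (t, y) := by
    intro t y k
    rw [hHapply, hHapply]
    refine integral_congr_ae (ae_of_all _ fun s => ?_)
    simp only [hGdef, Prod.fst_sub, Prod.snd_sub]
    rw [add_sub_right_comm, Torus.proj_add_latticeVec]
  -- time support: `g` vanishes outside `[a, b]`, hence `H` outside `[a - r, b + r]`
  obtain ⟨a, ha⟩ := (hgc.isCompact.image continuous_fst).bddBelow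
  obtain ⟨b, hb⟩ := (hgc.isCompact.image continuous_fst).bddAbove
  have hg0 : ∀ (t : ℝ) (x : UnitAddTorus d), t ∉ Icc a b → g (t, x) = 0 := by
    intro t x ht
    by_contra h
    exact ht ⟨ha ⟨(t, x), subset_tsupport _ (mem_support.2 h), rfl⟩,
      hb ⟨(t, x), subset_tsupport _ (mem_support.2 h), rfl⟩⟩
  have hH0 : ∀ (t : ℝ) (y : EuclideanSpace ℝ d), t ∉ Icc (a - r) (b + r) → H (t, y) = 0 := by
    intro t y ht
    rw [hHapply]
    refine integral_eq_zero_of_ae (ae_of_all _ fun s => ?_)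
    by_cases hs : β.normed volume s = 0
    · simp [hs]
    · have hs' : s ∈ ball (0 : ℝ × EuclideanSpace ℝ d) r := by
        rw [← β.support_normed_eq (μ := volume)]
        exact mem_support.2 hs
      rw [mem_ball_zero_iff, Prod.norm_def] at hs'
      have h1 : |s.1| < r := (le_max_left _ _).trans_lt hs'
      rw [abs_lt] at h1
      have ht' : t - s.1 ∉ Icc a b := by
        intro h
        simp only [mem_Icc, not_and_or, not_le] at ht h
        rcases ht with ht | ht <;> linarith [h.1, h.2]
      simp only [hGdef, Prod.fst_sub, Prod.snd_sub, Pi.zero_apply]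
      rw [hg0 _ _ ht', mul_zero]
  -- descend to the torus
  refine ⟨fun t x => H (t, Torus.repr x), ?_, ⟨a - r, b + r, fun t ht => ?_⟩, fun t x => ?_⟩
  · have hlift : Torus.stLift (fun t x => H (t, Torus.repr x)) = H := by
      funext p
      obtain ⟨k, hk⟩ := Torus.exists_repr_proj_eq_add_latticeVec_holds (d := d) p.2
      rw [Torus.stLift, hk, hper]
    rw [hlift]
    exact hHs
  · funext x
    exact hH0 t _ ht
  · have h := hHclose (t, Torus.repr x)
    simp only [hGdef, Torus.proj_repr] at h
    rwa [Real.dist_eq] at h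

/-! ### A du Bois-Reymond lemma for finite measures on `ℝ × T^d` -/

/-- Orthogonality to smooth space–time functions passes to `C_c(ℝ × T^d)` by uniform density:
if `∫ χ m dμ = 0` for all smooth `χ` vanishing outside a compact time interval, then
`∫ g m dμ = 0` for every continuous compactly supported `g`. [folklore] -/
theorem integral_mul_eq_zero_of_forall_smooth {μ : Measure (ℝ × UnitAddTorus d)}
    [IsFiniteMeasure μ] {m : ℝ × UnitAddTorus d → ℝ} (hm : Integrable m μ)
    (h : ∀ χ : ℝ → UnitAddTorus d → ℝ, ContDiff ℝ ∞ (Torus.stLift χ) →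
      (∃ a b : ℝ, ∀ t ∉ Icc a b, χ t = 0) → ∫ q, χ q.1 q.2 * m q ∂μ = 0)
    {g : ℝ × UnitAddTorus d → ℝ} (hg : Continuous g) (hgc : HasCompactSupport g) :
    ∫ q, g q * m q ∂μ = 0 := by
  -- `|∫ g m| ≤ δ ∫ |m|` for every `δ > 0`
  refine abs_nonpos_iff.1 (le_of_forall_pos_le_add fun ε hε => ?_)
  rw [zero_add]
  set I : ℝ := ∫ q, |m q| ∂μ with hI
  have hI0 : 0 ≤ I := integral_nonneg fun q => abs_nonneg _
  obtain ⟨χ, hχs, ⟨a, b, hab⟩, hχg⟩ := exists_smooth_near hg hgc (δ := ε / (I + 1)) (by positivity)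
  obtain ⟨hχc, C, hC⟩ := continuous_uncurry_and_bounded hχs hab
  obtain ⟨Cg, hCg⟩ := hg.bounded_above_of_compact_support hgc
  have hgm : Integrable (fun q => g q * m q) μ :=
    hm.bdd_mul hg.aestronglyMeasurable (ae_of_all _ hCg)
  have hχm : Integrable (fun q => χ q.1 q.2 * m q) μ :=
    hm.bdd_mul hχc.aestronglyMeasurable (ae_of_all _ fun q => hC q)
  have hsplit : ∫ q, g q * m q ∂μ = (∫ q, (g q - χ q.1 q.2) * m q ∂μ) + ∫ q, χ q.1 q.2 * m q ∂μ := by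
    rw [← integral_add ((hgm.sub hχm).congr (ae_of_all _ fun q => by
      simp only [Pi.sub_apply]; ring)) hχm]
    refine integral_congr_ae (ae_of_all _ fun q => ?_)
    ring
  rw [hsplit, h χ hχs ⟨a, b, hab⟩, add_zero]
  calc |∫ q, (g q - χ q.1 q.2) * m q ∂μ| ≤ ∫ q, |(g q - χ q.1 q.2) * m q| ∂μ :=
        abs_integral_le_integral_abs
    _ ≤ ∫ q, ε / (I + 1) * |m q| ∂μ := by
        refine integral_mono_of_nonneg (ae_of_all _ fun q => abs_nonneg _) (hm.abs.const_mul _)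
          (ae_of_all _ fun q => ?_)
        dsimp only
        rw [abs_mul]
        refine mul_le_mul_of_nonneg_right ?_ (abs_nonneg _)
        rw [abs_sub_comm]
        exact hχg q.1 q.2
    _ = ε / (I + 1) * I := by rw [integral_const_mul]
    _ ≤ ε := by
        rw [div_mul_eq_mul_div, div_le_iff₀ (by positivity)]
        nlinarith

/-- **du Bois-Reymond lemma on `ℝ × T^d`**: if `m ∈ L¹(μ)` for a finite Borel measure `μ` and
`∫ χ m dμ = 0` for every smooth space–time `χ` vanishing outside a compact time interval, then
`m = 0` `μ`-almost everywhere (Evans, §5.2.1; via `C_c` test functions, Urysohn functions of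
compact sets, dominated convergence and Mathlib's
`ae_eq_zero_of_forall_setIntegral_isCompact_eq_zero`). [folklore] -/
theorem ae_eq_zero_of_forall_smooth_integral_eq_zero {μ : Measure (ℝ × UnitAddTorus d)}
    [IsFiniteMeasure μ] {m : ℝ × UnitAddTorus d → ℝ} (hm : Integrable m μ)
    (h : ∀ χ : ℝ → UnitAddTorus d → ℝ, ContDiff ℝ ∞ (Torus.stLift χ) →
      (∃ a b : ℝ, ∀ t ∉ Icc a b, χ t = 0) → ∫ q, χ q.1 q.2 * m q ∂μ = 0) :
    m =ᵐ[μ] 0 := by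
  have hcont : ∀ g : ℝ × UnitAddTorus d → ℝ, Continuous g → HasCompactSupport g →
      ∫ q, g q * m q ∂μ = 0 := fun g hg hgc => integral_mul_eq_zero_of_forall_smooth hm h hg hgc
  refine ae_eq_zero_of_forall_setIntegral_isCompact_eq_zero hm fun s hs => ?_
  -- Urysohn functions `gₙ = 1` on `s`, supported in the `uₙ`-thickening of `s`
  obtain ⟨u, -, u_pos, u_lim⟩ : ∃ u : ℕ → ℝ, StrictAnti u ∧ (∀ n, u n ∈ Ioo (0 : ℝ) 1) ∧
      Tendsto u atTop (𝓝 0) := exists_seq_strictAnti_tendsto' one_pos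
  have hex : ∀ n, ∃ g : ℝ × UnitAddTorus d → ℝ, Continuous g ∧ HasCompactSupport g ∧
      EqOn g 1 s ∧ EqOn g 0 (thickening (u n) s)ᶜ ∧ ∀ x, g x ∈ Icc (0 : ℝ) 1 := by
    intro n
    obtain ⟨f, hf1, hf0, hfc, hf01⟩ := exists_continuous_one_zero_of_isCompact hs
      isOpen_thickening.isClosed_compl
      (disjoint_compl_right_iff_subset.2 (self_subset_thickening (u_pos n).1 s))
    exact ⟨f, f.continuous, hfc, hf1, hf0, hf01⟩
  choose g g_cont g_supp g_one g_zero g_range using hex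
  -- `∫ gₙ m → ∫_s m` by dominated convergence
  have L : Tendsto (fun n => ∫ q, g n q * m q ∂μ) atTop (𝓝 (∫ q in s, m q ∂μ)) := by
    rw [← integral_indicator hs.measurableSet]
    refine tendsto_integral_of_dominated_convergence (fun q => ‖m q‖)
      (fun n => ((g_cont n).aestronglyMeasurable.mul hm.aestronglyMeasurable)) hm.norm
      (fun n => ae_of_all _ fun q => ?_) (ae_of_all _ fun q => ?_)
    · rw [norm_mul]
      refine mul_le_of_le_one_left (norm_nonneg _) ?_
      rw [Real.norm_of_nonneg (g_range n q).1]
      exact (g_range n q).2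
    · by_cases hq : q ∈ s
      · have : ∀ n, g n q = 1 := fun n => g_one n hq
        simp [this, indicator_of_mem hq]
      · rw [indicator_of_notMem hq]
        apply tendsto_const_nhds.congr'
        obtain ⟨ε, εpos, hε⟩ : ∃ ε, 0 < ε ∧ q ∉ thickening ε s := by
          rw [← hs.isClosed.closure_eq, closure_eq_iInter_thickening s] at hq
          simpa using hq
        filter_upwards [(tendsto_order.1 u_lim).2 _ εpos] with n hn
        have : g n q = 0 := g_zero n (fun h' => hε (thickening_mono hn.le s h'))
        simp [this]
  have hzero : ∀ n, ∫ q, g n q * m q ∂μ = 0 := fun n => hcont _ (g_cont n) (g_supp n)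
  simp_rw [hzero] at L
  exact (tendsto_nhds_unique tendsto_const_nhds L).symm

end CodimensionOneRigidity

end Literature.Barriers.AnomalousDissipation

end
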